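import Summits.BirchSwinnertonDyer.BirchSwinnertonDyer.Theorems.PrintX10bTwoSidedLinkAnyClassNumberX10bOfPrintFactsPinnedLink
import Literature.NumberTheory.EllipticCurves.YanZhu2026.AnticyclotomicBDPOfHeegnerPointAnyClassNumber
import HarnessLib

/-!
# B₃^pin BY NAME at every class number: the pinned two-sided link
# `X11b.IMCWaldspurgerOnTreeGoodAt p κ (inducedPlace ι) γ ι P` (tie `F.Dt = Dt`, `p ∤ c(Dt)`) modulo SIX
# Literature named facts — the transfer hypothesis `h59gp` of the companions DISCHARGED by the
# class-number-free pinned typing of Yan–Zhu 2026 Thm. 5.9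
# (`YanZhu2026.thm59_XGr_isTorsion_bdp_of_heegnerPoint_localised_pinned_anyClassNumber`)

Cell `run/shared/lean/pub/bsd-print-x9/`, seat `bsd-line-x10b-p3` (gen 2; D-0154 row 10; crux
stmt-BirchSwinnertonDyer-23730 `PrintX10b.TwoSidedLinkAnyClassNumberX10b`, line `composite-transfer-x10b`).
HONEST FRAMING: theorems only (no definition, no named fact, no `sorry`); `--supports
stmt-BirchSwinnertonDyer-23730` (helper); route-independent (no `Theses` import: the pinned route items of
PrintX10b rev 20 / PrintX9 rev 20 are the planner's); nothing is closed here; every theorem is CONDITIONAL on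
the named print facts it lists (Literature `Prop`s, unproved in the tree); BSD is not proved by any of this and
no summit statement is proved by this seat.

## What this file adds to the companions (x10b-p3 g0: p607932 `…OfPrintFactsPinned`, p608225/p608727
## `…OfPrintFactsPinnedLink`)

The companions prove the pinned composite / valuation identity / two-sided link / B₃^pin body modulo
`(h57, h59gp, h422, h513, hC | hpar, h331)` where `h59gp` was an EXPLICIT ∀-hypothesis — Yan–Zhu Thm. 5.9
(2) ⟹ (1) at `S = {1}`, pinned (`¬ (p : ℤ) ∣ F.Dt.c`), on the class-number-free binder list. That
statement is now the `S = {1}` unfolding of the Literature named fact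
`YanZhu2026.thm59_XGr_isTorsion_bdp_of_heegnerPoint_localised_pinned_anyClassNumber` (Yan–Zhu Thm. 5.9
PINNED, read at every class number, only the two print-safe halves; proof-level flag
`YZ59-anyhK@BCK52-How04` at `p ∣ h_K` in its docstring). Hence:

* `pinnedTransfer_of_thm59AnyClassNumber` — the named fact ⟹ `h59gp`, letter for letter (3-line unfolding).
* `composite_of_printFactsByName`, `compositeValuation_of_printFactsByName` — the PINNED class-number-free
  Yan–Zhu ∘ BCS ∘ CGLS composite at the trivial character (the conclusion of the typed (T1)^pin
  `thm57_thm59_bcs422_cgls513_generator_constantCoeff_of_pinnedHeegnerDivisibility` WITH `¬ p ∣ h_K` DELETED)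
  and its valuation currency, DERIVED from five named facts: `thm57_isTorsion_charIdealXGr_eq_bdpLFunction`,
  the new Thm. 5.9 fact, `prop422_exists_isBDPLFunction_mu_eq_zero`, `thm513_exists_isBDPLFunction_valueAtOne_disc`,
  Carayol (`IsNewformOf.level_eq_conductorNorm`, or `nonempty_modularParametrizationData` by multiplicity one).
* `imcWaldspurgerOnTreeGoodAt_inducedPlace_of_printFactsByName` — PIN-1 turnkey T-G at EVERY class number and
  every good ordinary `p ≥ 3` (serves PrintX9's `TwoSidedLinkPinned[OfPrint]` and PrintX10b's
  `TwoSidedLinkAnyClassNumberX10bPinned[OfPrint]` alike), modulo the six named facts (+ `thm331_anticyclotomicControl`).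
* `twoSidedLinkAnyClassNumberX10bPinned_of_printFactsByName[_of_modularity]` — the announced B₃^pin body on
  crux 23730's binder list, modulo the six named facts: the rev-20 item
  `TwoSidedLinkAnyClassNumberX10bPinnedOfPrint := YZ57(1) → YZ59^pin_anyhK → BCS422 → CGLS513 →
  ModularParametrizationSupply → JSWAnticyclotomicControl → B₃^pin` closes by ONE `exact` of the last theorem.

By-name inputs and their cell flags (census, not hidden): `thm57_…` + `prop422_…` + `thm513_…disc` carry
`YZ26@3-BF-ERL-Ohta` at `p = 3`; the Thm. 5.9 fact carries `YZ59-anyhK@BCK52-How04` at `p ∣ h_K` (none at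
`p ∤ h_K`, where it is two halves of the accepted pinned typing); `thm331_…` none at `3 ≤ p`.

References: [YanZhu2024MainConjNonCM] §5.2, Thm. 5.7 (1), Thm. 5.9 (arXiv:2412.20078v4 l.1189–1308);
[BurungaleCastellaKim2021] §1.1, Remark 1.2, Thm. 5.2; [BurungaleCastellaSkinner2025] Prop. 4.2.2;
[CastellaGrossiLeeSkinner2022] Thm. 5.1.3; [JetchevSkinnerWan2017] Thm. 3.3.1; [Castella2018] Thm. 2.3, §5;
[Carayol1986]; [BCDTJAMS2001]; HOME/plan/findings/PIN-1-unpinned-heegner-family.md; HOME/REF-AUDIT.md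
REF-104/REF-106.
-/

-- the summit and its single problem are both named `BirchSwinnertonDyer` (registry layout D-0017)
set_option linter.dupNamespace false
set_option autoImplicit false

noncomputable section

open scoped Classical

open PowerSeries WeierstrassCurve NumberField IsDedekindDomain Field Literature.NumberTheory.EllipticCurves
  Literature.NumberTheory.EllipticCurves.ModularForms Literature.NumberTheory.EllipticCurves.Rank1Residual
  Literature.NumberTheory.EllipticCurves.Castella2018 Literature.NumberTheory.EllipticCurves.YanZhu2026
  Literature.NumberTheory.EllipticCurves.CastellaGrossiLeeSkinner2022
  Literature.NumberTheory.EllipticCurves.JetchevSkinnerWan2017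

open Summit.BirchSwinnertonDyer.Rank1Residual

namespace Summit.BirchSwinnertonDyer.BirchSwinnertonDyer.Cruxes.TwoSidedLinkAnyClassNumberX10b.CompositeTransferX10b

/-! ## §0 The transfer hypothesis `h59gp` BY NAME -/

/-- **`h59gp` by name.** The explicit pinned class-number-free transfer hypothesis of the companions
(`composite_of_printFacts_of_pinnedTransfer`, `imcWaldspurgerOnTreeGoodAt_inducedPlace_of_printFacts_of_pinnedTransfer`,
…) is the `S = {1}` unfolding of the Literature named fact
`YanZhu2026.thm59_XGr_isTorsion_bdp_of_heegnerPoint_localised_pinned_anyClassNumber` (Yan–Zhu 2026 Thm. 5.9,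
(2) ⟹ (1), pinned `¬ (p : ℤ) ∣ F.Dt.c`, every class number): with `s = 1` the localisation is trivial, so
`(heegnerCharIdeal D F)² ⊆ char(𝒳_tor)` gives `L ∈ char(𝒳_Gr)·R₀⟦T⟧`.
[cite: YanZhu2024MainConjNonCM, Thm. 5.9 and proof of Thm. 5.7 (arXiv:2412.20078v4 TeX l.1283–1308)]
[cite: BurungaleCastellaKim2021, Remark 1.2 and Thm. 5.2] -/
theorem pinnedTransfer_of_thm59AnyClassNumber
    (h59a : thm59_XGr_isTorsion_bdp_of_heegnerPoint_localised_pinned_anyClassNumber)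
    {p : ℕ} [Fact p.Prime] (ι' : PadicAlgCl p ≃+* ℂ) (W : WeierstrassCurve ℚ) [W.IsElliptic]
    [W.IsGloballyMinimal] (K : Type) [Field K] [NumberField K] (v vbar : HeightOneSpectrum (𝓞 K))
    (κ : ZpExtension K p) (γ : absoluteGaloisGroup K) [Fact (κ.IsTopGenerator γ)] {N : ℕ} [NeZero N]
    {f : CuspForm (CongruenceSubgroup.Gamma0 N) 2} (jbar : AlgebraicClosure K →+* ℂ)
    (hf : IsNewformOf W f) (hN : N = W.conductorNorm ℤ) (hp : 3 ≤ p) (hord : GoodOrd W p)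
    (hirr : (W.baseChange K).HasIrreducibleModPGaloisRep p) (hK : IsImaginaryQuadratic K)
    (hH : SatisfiesHeegnerHypothesis N K) (hsplit : ((Ideal.span {(p : ℤ)}).primesOver (𝓞 K)).ncard = 2)
    (hodd : Odd (NumberField.discr K)) (h3 : NumberField.discr K ≠ -3) (hκ : κ.IsAnticyclotomic)
    (hι : ∀ (w : InfinitePlace K) (k : 𝓞 K), k ∈ v.asIdeal ↔ ‖ι'.symm (w.embedding (k : K))‖ < 1)
    (hvbar : ((p : ℕ) : 𝓞 K) ∈ vbar.asIdeal) (hne : vbar ≠ v) :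
    ∃ (ΩK : ℂ) (Ωp : (unrIntegers p)ˣ) (L : UnrSeries p),
      ΩK ≠ 0 ∧ IsBDPLFunction ι' v κ γ f ΩK ((Ωp : unrIntegers p) : ℂ_[p]) L ∧
      ∀ (D : (W.baseChange K).LambdaAdicSelmerData κ γ) (F : HeegnerFamily N W K κ jbar)
        (X : (W.baseChange K).SelmerDualData κ γ) (j : ℤ_[p] →+* unrIntegers p),
        ¬ (p : ℤ) ∣ F.Dt.c →
        (∀ x : ℤ_[p], ((j x : unrIntegers p) : ℂ_[p]) = algebraMap ℚ_[p] ℂ_[p] (x : ℚ_[p])) →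
        heegnerCharIdeal D F ^ 2 ≤
            Module.charIdeal (IwasawaAlgebra p) (Submodule.torsion (IwasawaAlgebra p) X.X) →
          L ∈ (AcSelmer.XAc.charIdeal (W.baseChange K) p κ vbar ∅ γ).map (PowerSeries.map j) := by
  obtain ⟨ΩK, Ωp, L, hΩK, hL, -, himp⟩ :=
    h59a ι' W K v vbar κ γ jbar hf hN hp hord hirr hK hH hsplit hodd h3 hκ hι hvbar hne
  refine ⟨ΩK, Ωp, L, hΩK, hL, fun D F X j hc hj hle ↦ ?_⟩
  have h1 : ∃ n : ℕ, ∀ g ∈ heegnerCharIdeal D F ^ 2,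
      (1 : IwasawaAlgebra p) ^ n * g ∈
        Module.charIdeal (IwasawaAlgebra p) (Submodule.torsion (IwasawaAlgebra p) X.X) :=
    ⟨0, fun g hg ↦ by rw [pow_zero, one_mul]; exact hle hg⟩
  obtain ⟨n, hn⟩ := (himp D F X j hc hj 1 one_ne_zero).1 h1
  rwa [map_one, one_pow, one_mul] at hn

/-! ## §1 The pinned class-number-free composite at the trivial character, BY NAME -/

/-- **(T1)^pin with `¬ p ∣ h_K` DELETED, DERIVED from five named print facts.** Yan–Zhu 2026 Thm. 5.7 (1)
(`h57`) + Thm. 5.9 pinned at every class number (`h59a`, (2) ⟹ (1) at `S = {1}`) + BCS 2025 Prop. 4.2.2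
(`h422`) + CGLS 2022 Thm. 5.1.3 (`h513`) + Carayol (`hC`): at every good ordinary `p ≥ 3` frame (Heegner for
`N_E` and `p`, `d_K` odd `≠ −3`, (irr_K), ANY class number), GRANTED Howard's containment for a PINNED family
(`∃ jbar D F X, ¬ (p : ℤ) ∣ F.Dt.c ∧ heegnerCharIdeal D F ^ 2 ≤ char(torsion X.X)`), `𝒳_Gr` is torsion and a
generator `F` of `Char_Λ(𝒳_Gr)` has `F(0) = u·c(Dt)⁻²(1 − a_p p⁻¹ + p⁻¹)² log_ω(P)²`, `u ∈ ℤ_pˣ` — verbatim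
the conclusion of `YanZhu2026.thm57_thm59_bcs422_cgls513_generator_constantCoeff_of_pinnedHeegnerDivisibility`
WITHOUT its binder `¬ p ∣ NumberField.classNumber K`. One line from the companion
`composite_of_printFacts_of_pinnedTransfer` with `h59gp := pinnedTransfer_of_thm59AnyClassNumber h59a`.
[cite: YanZhu2024MainConjNonCM, Thm. 5.7 (1) and Thm. 5.9 (arXiv:2412.20078v4 TeX l.1217–1227, l.1283–1293)]
[cite: BurungaleCastellaSkinner2025, Prop. 4.2.2 (p. 9)] [cite: CastellaGrossiLeeSkinner2022, Thm. 5.1.3]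
[cite: Carayol1986] -/
theorem composite_of_printFactsByName
    (h57 : thm57_isTorsion_charIdealXGr_eq_bdpLFunction)
    (h59a : thm59_XGr_isTorsion_bdp_of_heegnerPoint_localised_pinned_anyClassNumber)
    (h422 : BurungaleCastellaSkinner2025.prop422_exists_isBDPLFunction_mu_eq_zero)
    (h513 : thm513_exists_isBDPLFunction_valueAtOne_disc)
    (hC : ∀ (N : ℕ) [NeZero N], IsNewformOf.level_eq_conductorNorm (N := N)) :
    ∀ (W : WeierstrassCurve ℚ) [W.IsElliptic] [W.IsGloballyMinimal] (p : ℕ) [Fact p.Prime],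
      3 ≤ p → GoodOrd W p →
      ∀ (K : Type) [Field K] [NumberField K], IsImaginaryQuadratic K →
        SatisfiesHeegnerHypothesis (W.conductorNorm ℤ) K → SatisfiesHeegnerHypothesis p K →
        Odd (NumberField.discr K) → NumberField.discr K ≠ -3 →
        (W.baseChange K).HasIrreducibleModPGaloisRep p →
      ∀ (ι : K →+* ℚ_[p]) (v vbar : HeightOneSpectrum (𝓞 K)),
        (∀ x : 𝓞 K, x ∈ v.asIdeal ↔ ‖ι (x : K)‖ < 1) →
        ((p : ℕ) : 𝓞 K) ∈ vbar.asIdeal → vbar ≠ v →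
      ∀ (κ : ZpExtension K p), κ.IsAnticyclotomic →
      ∀ (γ : absoluteGaloisGroup K) [Fact (κ.IsTopGenerator γ)],
      ∀ (N : ℕ) [NeZero N] (Dt : ModularParametrizationData W N)
        (H : HeegnerDatum N (NumberField.discr K)) (ιC : K →+* ℂ) (P : (W.baseChange K).toAffine.Point),
        WeierstrassCurve.Affine.Point.map ιC.toRatAlgHom P = heegnerPointComplex Dt H →
        (∃ (jbar : AlgebraicClosure K →+* ℂ) (D : (W.baseChange K).LambdaAdicSelmerData κ γ)
            (F : HeegnerFamily N W K κ jbar) (X : (W.baseChange K).SelmerDualData κ γ),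
            ¬ (p : ℤ) ∣ F.Dt.c ∧ heegnerCharIdeal D F ^ 2 ≤
              Module.charIdeal (IwasawaAlgebra p) (Submodule.torsion (IwasawaAlgebra p) X.X)) →
        Module.IsTorsion (IwasawaAlgebra p) (AcSelmer.XAc (W.baseChange K) p κ vbar ∅ γ) ∧
        ∃ F : IwasawaAlgebra p,
          AcSelmer.XAc.charIdeal (W.baseChange K) p κ vbar ∅ γ = Ideal.span {F} ∧
          ∃ u : ℤ_[p]ˣ,
            ((PowerSeries.constantCoeff F : ℤ_[p]) : ℚ_[p]) =
              ((u : ℤ_[p]) : ℚ_[p]) * ((Dt.c : ℚ_[p])⁻¹) ^ 2 *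
                (1 - (W.frobeniusTrace p : ℚ_[p]) * (p : ℚ_[p])⁻¹ + (p : ℚ_[p])⁻¹) ^ 2 *
                ((W.baseChange ℚ_[p]).padicLogPoint (formalIndex W p • padicPointOf W p ι P) /
                  (formalIndex W p : ℚ_[p])) ^ 2 :=
  composite_of_printFacts_of_pinnedTransfer h57
    (fun ι' W _ _ K _ _ v vbar κ γ _ _ _ _ jbar hf hN hp hord hirr hK hH hsplit hodd h3 hκ hι hvbar hne ↦
      pinnedTransfer_of_thm59AnyClassNumber h59a ι' W K v vbar κ γ jbar hf hN hp hord hirr hK hH hsplit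
        hodd h3 hκ hι hvbar hne)
    h422 h513 hC

/-- **The PINNED class-number-free composite valuation identity, BY NAME**: at every good ordinary `p ≥ 3`
frame (ANY class number), Howard's containment for a PINNED family and one generator `G` of `Char_Λ(𝒳_Gr)`
with `G(0) ≠ 0` give `AcSelmer.XAc.HasCharValuationAt … n` with
`n = 2·(ord_p(1 − a_p + p) − 1 + ord_p log_ω P) − 2·ord_p c(Dt)`, modulo the five named facts. One line from
the companion `compositeValuation_of_printFacts_of_pinnedTransfer`.
[cite: YanZhu2024MainConjNonCM, Thm. 5.7 (1) and Thm. 5.9] [cite: BurungaleCastellaSkinner2025, Prop. 4.2.2]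
[cite: CastellaGrossiLeeSkinner2022, Thm. 5.1.3] [cite: Castella2018, §5 (eq:IMC+BDP)] -/
theorem compositeValuation_of_printFactsByName
    (h57 : thm57_isTorsion_charIdealXGr_eq_bdpLFunction)
    (h59a : thm59_XGr_isTorsion_bdp_of_heegnerPoint_localised_pinned_anyClassNumber)
    (h422 : BurungaleCastellaSkinner2025.prop422_exists_isBDPLFunction_mu_eq_zero)
    (h513 : thm513_exists_isBDPLFunction_valueAtOne_disc)
    (hC : ∀ (N : ℕ) [NeZero N], IsNewformOf.level_eq_conductorNorm (N := N)) :
    ∀ (W : WeierstrassCurve ℚ) [W.IsElliptic] [W.IsGloballyMinimal] (p : ℕ) [Fact p.Prime],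
      3 ≤ p → GoodOrd W p →
      ∀ (K : Type) [Field K] [NumberField K], IsImaginaryQuadratic K →
        SatisfiesHeegnerHypothesis (W.conductorNorm ℤ) K → SatisfiesHeegnerHypothesis p K →
        Odd (NumberField.discr K) → NumberField.discr K ≠ -3 →
        (W.baseChange K).HasIrreducibleModPGaloisRep p →
      ∀ (ι : K →+* ℚ_[p]) (v vbar : HeightOneSpectrum (𝓞 K)),
        (∀ x : 𝓞 K, x ∈ v.asIdeal ↔ ‖ι (x : K)‖ < 1) →
        ((p : ℕ) : 𝓞 K) ∈ vbar.asIdeal → vbar ≠ v →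
      ∀ (κ : ZpExtension K p), κ.IsAnticyclotomic →
      ∀ (γ : absoluteGaloisGroup K) [Fact (κ.IsTopGenerator γ)],
      ∀ (N : ℕ) [NeZero N] (Dt : ModularParametrizationData W N)
        (H : HeegnerDatum N (NumberField.discr K)) (ιC : K →+* ℂ) (P : (W.baseChange K).toAffine.Point),
        WeierstrassCurve.Affine.Point.map ιC.toRatAlgHom P = heegnerPointComplex Dt H →
        (∃ (jbar : AlgebraicClosure K →+* ℂ) (D : (W.baseChange K).LambdaAdicSelmerData κ γ)
            (F : HeegnerFamily N W K κ jbar) (X : (W.baseChange K).SelmerDualData κ γ),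
            ¬ (p : ℤ) ∣ F.Dt.c ∧ heegnerCharIdeal D F ^ 2 ≤
              Module.charIdeal (IwasawaAlgebra p) (Submodule.torsion (IwasawaAlgebra p) X.X)) →
      ∀ (G : IwasawaAlgebra p),
        AcSelmer.XAc.charIdeal (W.baseChange K) p κ vbar ∅ γ = Ideal.span {G} →
        PowerSeries.constantCoeff G ≠ 0 →
        ∃ n : ℕ, AcSelmer.XAc.HasCharValuationAt (W.baseChange K) p κ vbar ∅ γ n ∧
          (n : ℤ) = 2 * ((padicValInt p (1 - W.frobeniusTrace p + p) : ℤ) - 1 +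
            Literature.NumberTheory.EllipticCurves.padicLogOrd W p ι P) - 2 * (padicValInt p Dt.c : ℤ) :=
  compositeValuation_of_printFacts_of_pinnedTransfer h57
    (fun ι' W _ _ K _ _ v vbar κ γ _ _ _ _ jbar hf hN hp hord hirr hK hH hsplit hodd h3 hκ hι hvbar hne ↦
      pinnedTransfer_of_thm59AnyClassNumber h59a ι' W K v vbar κ γ jbar hf hN hp hord hirr hK hH hsplit
        hodd h3 hκ hι hvbar hne)
    h422 h513 hC

/-! ## §2 The two-sided link and B₃^pin, BY NAME -/

/-- **PIN-1 turnkey T-G at every class number, BY NAME: the TWO-SIDED link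
`X11b.IMCWaldspurgerOnTreeGoodAt p κ (inducedPlace ι) γ ι P`** at a good ordinary `p ≥ 3`, (irr_K), rank one,
`Ш[p^∞]` finite, `p ∤ c(Dt)`, GRANTED Howard's containment for a family TIED to `Dt`
(`∃ jbar D F X, F.Dt = Dt ∧ I(ℋ_F)² ⊆ char(X_tors)`), modulo SIX named facts: `h57` (Yan–Zhu Thm. 5.7 (1)),
`h59a` (Yan–Zhu Thm. 5.9 pinned, every class number), `h422` (BCS Prop. 4.2.2), `h513` (CGLS Thm. 5.1.3), `hC`
(Carayol) and `h331` (JSW Thm. 3.3.1). NO hypothesis on `h_K`, NO image hypothesis. One line from the companion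
`imcWaldspurgerOnTreeGoodAt_inducedPlace_of_printFacts_of_pinnedTransfer`; generic in `p ≥ 3` (serves PrintX9's
`TwoSidedLinkPinned[OfPrint]` and TorsionLayerDescent alike).
[cite: YanZhu2024MainConjNonCM, Thm. 5.7 (1) and Thm. 5.9, §5.2] [cite: BurungaleCastellaSkinner2025, Prop. 4.2.2]
[cite: CastellaGrossiLeeSkinner2022, Thm. 5.1.3] [cite: JetchevSkinnerWan2017, Thm. 3.3.1, §2.3.2, §7.4.1]
[cite: Castella2018, Thm. 2.3, §5 (eq:IMC+BDP)] [cite: PerrinRiou1987BSMF, §1 Conj. B (the normalisation `c_π`)] -/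
theorem imcWaldspurgerOnTreeGoodAt_inducedPlace_of_printFactsByName
    (h57 : thm57_isTorsion_charIdealXGr_eq_bdpLFunction)
    (h59a : thm59_XGr_isTorsion_bdp_of_heegnerPoint_localised_pinned_anyClassNumber)
    (h422 : BurungaleCastellaSkinner2025.prop422_exists_isBDPLFunction_mu_eq_zero)
    (h513 : thm513_exists_isBDPLFunction_valueAtOne_disc)
    (hC : ∀ (N : ℕ) [NeZero N], IsNewformOf.level_eq_conductorNorm (N := N))
    (h331 : thm331_anticyclotomicControl)
    {W : WeierstrassCurve ℚ} [W.IsElliptic] [W.IsGloballyMinimal] {p : ℕ} [Fact p.Prime]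
    {K : Type} [Field K] [NumberField K]
    (hp : 3 ≤ p) (hord : GoodOrd W p)
    (hK : IsImaginaryQuadratic K) (hodd : Odd (NumberField.discr K)) (h3 : NumberField.discr K ≠ -3)
    {N : ℕ} [NeZero N] (hN : W.conductorNorm ℤ = N) (hHN : SatisfiesHeegnerHypothesis N K)
    (hHp : SatisfiesHeegnerHypothesis p K) (hirrK : (W.baseChange K).HasIrreducibleModPGaloisRep p)
    (ι : K →+* ℚ_[p]) (κ : ZpExtension K p) (hκ : κ.IsAnticyclotomic)
    (γ : Field.absoluteGaloisGroup K) [Fact (κ.IsTopGenerator γ)]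
    (Dt : ModularParametrizationData W N) (hc : ¬ (p : ℤ) ∣ Dt.c)
    (H : HeegnerDatum N (NumberField.discr K)) (ιC : K →+* ℂ) (P : (W.baseChange K).toAffine.Point)
    (hP : WeierstrassCurve.Affine.Point.map ιC.toRatAlgHom P = heegnerPointComplex Dt H)
    (hrk : (W.baseChange K).mordellWeilRank = 1)
    (hfinp : Finite (AddCommGroup.primaryComponent (W.baseChange K).sha p))
    (hPinf : ¬ IsOfFinAddOrder P)
    (hHow : ∃ (jbar : AlgebraicClosure K →+* ℂ) (D : (W.baseChange K).LambdaAdicSelmerData κ γ)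
      (F : HeegnerFamily N W K κ jbar) (X : (W.baseChange K).SelmerDualData κ γ),
      F.Dt = Dt ∧ heegnerCharIdeal D F ^ 2 ≤
        Module.charIdeal (IwasawaAlgebra p) (Submodule.torsion (IwasawaAlgebra p) X.X)) :
    X11b.IMCWaldspurgerOnTreeGoodAt p κ (X11b.inducedPlace ι) γ ι P :=
  imcWaldspurgerOnTreeGoodAt_inducedPlace_of_printFacts_of_pinnedTransfer h57
    (fun ι' W _ _ K _ _ v vbar κ γ _ _ _ _ jbar hf hN hp hord hirr hK hH hsplit hodd h3 hκ hι hvbar hne ↦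
      pinnedTransfer_of_thm59AnyClassNumber h59a ι' W K v vbar κ γ jbar hf hN hp hord hirr hK hH hsplit
        hodd h3 hκ hι hvbar hne)
    h422 h513 hC h331 hp hord hK hodd h3 hN hHN hHp hirrK ι κ hκ γ Dt hc H ιC P hP hrk hfinp hPinf hHow

/-- **B₃^pin BY NAME: the pinned body announced for `PrintX10b.TwoSidedLinkAnyClassNumberX10bPinned`
(PIN-1 (R3)) on the binder list of crux stmt-BirchSwinnertonDyer-23730** (`ClassX10 W p`, `¬ Surj W 3`, `¬ CM`,
`K` imaginary quadratic with `d_K` odd `≠ −3`, Heegner for `N_E` and `p`, (irr_K), `ι`, `κ` anticyclotomic with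
generator `γ`, `Dt` with `p ∤ c(Dt)`, `H`, `ιC`, `P ↦ y_K`, rank one, `Ш[p^∞]` finite, `P` non-torsion; containment
hypothesis TIED by `F.Dt = Dt`) AT EVERY CLASS NUMBER, modulo the six named facts
`(h57, h59a, h422, h513, hC, h331)`. The rev-20 crux
`TwoSidedLinkAnyClassNumberX10bPinnedOfPrint` (print facts → B₃^pin) closes by one `exact` of this theorem (or of
its `_of_modularity` form). [cite: YanZhu2024MainConjNonCM, Thm. 5.7 (1) and Thm. 5.9]
[cite: BurungaleCastellaSkinner2025, Prop. 4.2.2] [cite: CastellaGrossiLeeSkinner2022, Thm. 5.1.3]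
[cite: JetchevSkinnerWan2017, Thm. 3.3.1] [cite: Carayol1986] -/
theorem twoSidedLinkAnyClassNumberX10bPinned_of_printFactsByName
    (h57 : thm57_isTorsion_charIdealXGr_eq_bdpLFunction)
    (h59a : thm59_XGr_isTorsion_bdp_of_heegnerPoint_localised_pinned_anyClassNumber)
    (h422 : BurungaleCastellaSkinner2025.prop422_exists_isBDPLFunction_mu_eq_zero)
    (h513 : thm513_exists_isBDPLFunction_valueAtOne_disc)
    (hC : ∀ (N : ℕ) [NeZero N], IsNewformOf.level_eq_conductorNorm (N := N))
    (h331 : thm331_anticyclotomicControl) :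
    ∀ (W : WeierstrassCurve ℚ) [W.IsElliptic] [W.IsGloballyMinimal] (p : ℕ) [Fact p.Prime]
      [NeZero (W.conductorNorm ℤ)] (K : Type) [Field K] [NumberField K],
      Literature.NumberTheory.EllipticCurves.Rank1Residual.ClassX10 W p →
      ¬ Literature.NumberTheory.EllipticCurves.Rank1Residual.Surj W 3 → ¬ W.HasCM →
      IsImaginaryQuadratic K → Odd (NumberField.discr K) → NumberField.discr K ≠ -3 →
      SatisfiesHeegnerHypothesis (W.conductorNorm ℤ) K → SatisfiesHeegnerHypothesis p K →
      (W.baseChange K).HasIrreducibleModPGaloisRep p →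
      ∀ (ι : K →+* ℚ_[p]) (κ : ZpExtension K p), κ.IsAnticyclotomic →
      ∀ (γ : Field.absoluteGaloisGroup K) [Fact (κ.IsTopGenerator γ)]
        (Dt : ModularParametrizationData W (W.conductorNorm ℤ)), ¬ (p : ℤ) ∣ Dt.c →
      ∀ (H : HeegnerDatum (W.conductorNorm ℤ) (NumberField.discr K)) (ιC : K →+* ℂ)
        (P : (W.baseChange K).toAffine.Point),
        WeierstrassCurve.Affine.Point.map ιC.toRatAlgHom P = heegnerPointComplex Dt H →
        (W.baseChange K).mordellWeilRank = 1 →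
        Finite (AddCommGroup.primaryComponent (W.baseChange K).sha p) → ¬ IsOfFinAddOrder P →
        (∃ (jbar : AlgebraicClosure K →+* ℂ) (D : (W.baseChange K).LambdaAdicSelmerData κ γ)
            (F : HeegnerFamily (W.conductorNorm ℤ) W K κ jbar) (X : (W.baseChange K).SelmerDualData κ γ),
            F.Dt = Dt ∧ heegnerCharIdeal D F ^ 2 ≤
              Module.charIdeal (IwasawaAlgebra p) (Submodule.torsion (IwasawaAlgebra p) X.X)) →
        X11b.IMCWaldspurgerOnTreeGoodAt p κ (X11b.inducedPlace ι) γ ι P :=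
  twoSidedLinkAnyClassNumberX10bPinned_of_printFacts_of_pinnedTransfer h57
    (fun ι' W _ _ K _ _ v vbar κ γ _ _ _ _ jbar hf hN hp hord hirr hK hH hsplit hodd h3 hκ hι hvbar hne ↦
      pinnedTransfer_of_thm59AnyClassNumber h59a ι' W K v vbar κ γ jbar hf hN hp hord hirr hK hH hsplit
        hodd h3 hκ hι hvbar hne)
    h422 h513 hC h331

/-- **The same with Carayol supplied BY NAME by modularity** (`nonempty_modularParametrizationData`, BCDT 2001;
`IsNewformOf.level_eq_conductorNorm` is then a tree theorem by multiplicity one): B₃^pin at every class number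
modulo SIX named inputs ALL of which are Literature `Prop`s — `thm57_isTorsion_charIdealXGr_eq_bdpLFunction`,
`thm59_XGr_isTorsion_bdp_of_heegnerPoint_localised_pinned_anyClassNumber`, `prop422_exists_isBDPLFunction_mu_eq_zero`,
`thm513_exists_isBDPLFunction_valueAtOne_disc`, `nonempty_modularParametrizationData`, `thm331_anticyclotomicControl`.
[cite: YanZhu2024MainConjNonCM, Thm. 5.7 (1) and Thm. 5.9] [cite: BCDTJAMS2001, Thm. A] [cite: Carayol1986]
[cite: JetchevSkinnerWan2017, Thm. 3.3.1] -/
theorem twoSidedLinkAnyClassNumberX10bPinned_of_printFactsByName_of_modularity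
    (h57 : thm57_isTorsion_charIdealXGr_eq_bdpLFunction)
    (h59a : thm59_XGr_isTorsion_bdp_of_heegnerPoint_localised_pinned_anyClassNumber)
    (h422 : BurungaleCastellaSkinner2025.prop422_exists_isBDPLFunction_mu_eq_zero)
    (h513 : thm513_exists_isBDPLFunction_valueAtOne_disc)
    (hpar : nonempty_modularParametrizationData)
    (h331 : thm331_anticyclotomicControl) :
    ∀ (W : WeierstrassCurve ℚ) [W.IsElliptic] [W.IsGloballyMinimal] (p : ℕ) [Fact p.Prime]
      [NeZero (W.conductorNorm ℤ)] (K : Type) [Field K] [NumberField K],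
      Literature.NumberTheory.EllipticCurves.Rank1Residual.ClassX10 W p →
      ¬ Literature.NumberTheory.EllipticCurves.Rank1Residual.Surj W 3 → ¬ W.HasCM →
      IsImaginaryQuadratic K → Odd (NumberField.discr K) → NumberField.discr K ≠ -3 →
      SatisfiesHeegnerHypothesis (W.conductorNorm ℤ) K → SatisfiesHeegnerHypothesis p K →
      (W.baseChange K).HasIrreducibleModPGaloisRep p →
      ∀ (ι : K →+* ℚ_[p]) (κ : ZpExtension K p), κ.IsAnticyclotomic →
      ∀ (γ : Field.absoluteGaloisGroup K) [Fact (κ.IsTopGenerator γ)]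
        (Dt : ModularParametrizationData W (W.conductorNorm ℤ)), ¬ (p : ℤ) ∣ Dt.c →
      ∀ (H : HeegnerDatum (W.conductorNorm ℤ) (NumberField.discr K)) (ιC : K →+* ℂ)
        (P : (W.baseChange K).toAffine.Point),
        WeierstrassCurve.Affine.Point.map ιC.toRatAlgHom P = heegnerPointComplex Dt H →
        (W.baseChange K).mordellWeilRank = 1 →
        Finite (AddCommGroup.primaryComponent (W.baseChange K).sha p) → ¬ IsOfFinAddOrder P →
        (∃ (jbar : AlgebraicClosure K →+* ℂ) (D : (W.baseChange K).LambdaAdicSelmerData κ γ)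
            (F : HeegnerFamily (W.conductorNorm ℤ) W K κ jbar) (X : (W.baseChange K).SelmerDualData κ γ),
            F.Dt = Dt ∧ heegnerCharIdeal D F ^ 2 ≤
              Module.charIdeal (IwasawaAlgebra p) (Submodule.torsion (IwasawaAlgebra p) X.X)) →
        X11b.IMCWaldspurgerOnTreeGoodAt p κ (X11b.inducedPlace ι) γ ι P :=
  twoSidedLinkAnyClassNumberX10bPinned_of_printFactsByName h57 h59a h422 h513
    (fun _ _ ↦ IsNewformOf.level_eq_conductorNorm_of_exists_isNewformOf'
      (exists_isNewformOf_of_nonempty_modularParametrizationData hpar)) h331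

end Summit.BirchSwinnertonDyer.BirchSwinnertonDyer.Cruxes.TwoSidedLinkAnyClassNumberX10b.CompositeTransferX10b

end
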